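import Mathlib
import HarnessLib
import Summits.NavierStokesRegularity.NavierStokesRegularity.Theorems.PoloidalWindowDoorLrcModEntireTwistingTHJetEndgame

/-!
# Item `LrcModEntire` (stmt-NavierStokesRegularity-20428), registry twist_split v7 — A PROPER HOT RIDGE MAKES THE THREAD PLANE NON-FLAT
# (the input `hne` of `…TwistingTHSlopeFunction.exists_slopeFunction_near_plane` from the binders of `stub_T2b`)

LEAD of item 20428 ns-poloidal-K2-p3 g14 (`--supports stmt-NavierStokesRegularity-20428 --as helper`).  CLASS-FREE calculus:

* `eq_on_plane_of_horizFDeriv_eq_zero` — a `C¹` function `f : ℝ³ → ℝ` whose horizontal partials `∂₀f`, `∂₁f` vanish on the plane `{y₂ = 0}` is constant there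
  (restrict to the affine chart of the plane; zero derivative on `ℝ²`);
* `exists_horizFDeriv_ne_zero_of_properRidge` — if `v₂(−1,·)` is `C¹`, `0` is hot and some point of the plane is NOT hot (the «empty planar interior» clause of the ridge cells gives one
  near every hot point), then `∂_c v₂(−1, y₁) ≠ 0` for some `y₁` of the plane and some horizontal `c` — the thread plane is non-flat, so `exists_slopeFunction_near_plane` applies
  and, with `…TwistingTHRidgeLaw`, the ridge law holds along the hot set.

WHAT THIS IS NOT: not a claim about Navier–Stokes regularity — plumbing for `stub_T2b` (bears_on LADDER-NS N0, item 20428 / crux 19708; both OPEN, ⟨27893⟩ OPEN).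
-/

noncomputable section

-- the summit and its single sub-problem share the name (CONVENTIONS §1), as in every Theorems file
set_option linter.dupNamespace false

namespace Summit.NavierStokesRegularity.NavierStokesRegularity.Theorems.PoloidalWindowDoorLrcModEntireTwistingTHNonflatPlane

open Set Function Filter Topology
open Summit.NavierStokesRegularity.NavierStokesRegularity.Theorems.PoloidalWindowDoorLrcModEntireTwistingTHJetEndgame

/-- The affine chart of the plane `{y₂ = 0}`: `a ↦ a₀e₀ + a₁e₁`. -/
theorem exists_planeChart :
    ∃ L : EuclideanSpace ℝ (Fin 2) →L[ℝ] EuclideanSpace ℝ (Fin 3),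
      (∀ a, L a 2 = 0) ∧ (L (EuclideanSpace.single 0 1) = EuclideanSpace.single 0 1) ∧ (L (EuclideanSpace.single 1 1) = EuclideanSpace.single 1 1) ∧
      ∀ x : EuclideanSpace ℝ (Fin 3), x 2 = 0 → ∃ a, L a = x := by
  let L : EuclideanSpace ℝ (Fin 2) →L[ℝ] EuclideanSpace ℝ (Fin 3) :=
    (EuclideanSpace.proj (𝕜 := ℝ) (0 : Fin 2)).smulRight (EuclideanSpace.single 0 1) +
      (EuclideanSpace.proj (𝕜 := ℝ) (1 : Fin 2)).smulRight (EuclideanSpace.single 1 1)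
  refine ⟨L, fun a => by simp [L], by ext j; fin_cases j <;> simp [L], by ext j; fin_cases j <;> simp [L], fun x hx => ?_⟩
  refine ⟨EuclideanSpace.single 0 (x 0) + EuclideanSpace.single 1 (x 1), ?_⟩
  ext j
  fin_cases j <;> simp [L, hx]

/-- **A `C¹` function with vanishing horizontal partials on the plane `{y₂ = 0}` is constant on that plane.** -/
theorem eq_on_plane_of_horizFDeriv_eq_zero {f : EuclideanSpace ℝ (Fin 3) → ℝ} (hf : Differentiable ℝ f)
    (h0 : ∀ y : EuclideanSpace ℝ (Fin 3), y 2 = 0 → fderiv ℝ f y (EuclideanSpace.single 0 1) = 0)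
    (h1 : ∀ y : EuclideanSpace ℝ (Fin 3), y 2 = 0 → fderiv ℝ f y (EuclideanSpace.single 1 1) = 0)
    (y y' : EuclideanSpace ℝ (Fin 3)) (hy : y 2 = 0) (hy' : y' 2 = 0) : f y = f y' := by
  obtain ⟨L, hL2, hL0, hL1, hsurj⟩ := exists_planeChart
  obtain ⟨a, rfl⟩ := hsurj y hy
  obtain ⟨a', rfl⟩ := hsurj y' hy'
  -- `f ∘ L` has zero derivative on `ℝ²`
  have hg : Differentiable ℝ (f ∘ L) := hf.comp L.differentiable
  have hzero : ∀ b : EuclideanSpace ℝ (Fin 2), fderiv ℝ (f ∘ L) b = 0 := by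
    intro b
    have hc : fderiv ℝ (f ∘ L) b = (fderiv ℝ f (L b)).comp L := ((hf (L b)).hasFDerivAt.comp b L.hasFDerivAt).fderiv
    rw [hc]
    -- a linear map on `ℝ²` vanishing on the basis is zero
    have hb0 : ((fderiv ℝ f (L b)).comp L) (EuclideanSpace.single 0 1) = 0 := by
      rw [ContinuousLinearMap.comp_apply, hL0]; exact h0 _ (hL2 b)
    have hb1 : ((fderiv ℝ f (L b)).comp L) (EuclideanSpace.single 1 1) = 0 := by
      rw [ContinuousLinearMap.comp_apply, hL1]; exact h1 _ (hL2 b)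
    exact clm_eq_zero_of_basis hb0 hb1
  exact is_const_of_fderiv_eq_zero hg hzero a a'

/-- **A proper hot ridge makes the thread plane non-flat.**  If `y ↦ v₂(−1,y)` is `C¹`, the origin is hot and some point of the plane `{y₂ = 0}` is not (`v₂(−1,y′) ≠ v₂(−1,0)`),
then some horizontal partial of `v₂(−1,·)` is non-zero at some point of the plane. -/
theorem exists_horizFDeriv_ne_zero_of_properRidge {v : ℝ → EuclideanSpace ℝ (Fin 3) → EuclideanSpace ℝ (Fin 3)}
    (hd : Differentiable ℝ fun y : EuclideanSpace ℝ (Fin 3) => v (-1) y 2)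
    (hproper : ∃ y' : EuclideanSpace ℝ (Fin 3), y' 2 = 0 ∧ v (-1) y' 2 ≠ v (-1) 0 2) :
    ∃ y₁ : EuclideanSpace ℝ (Fin 3), y₁ 2 = 0 ∧ ∃ c : Fin 3, c ≠ 2 ∧
      fderiv ℝ (fun y : EuclideanSpace ℝ (Fin 3) => v (-1) y 2) y₁ (EuclideanSpace.single c 1) ≠ 0 := by
  by_contra hcon
  push Not at hcon
  obtain ⟨y', hy', hne⟩ := hproper
  have h0 : ∀ y : EuclideanSpace ℝ (Fin 3), y 2 = 0 → fderiv ℝ (fun y : EuclideanSpace ℝ (Fin 3) => v (-1) y 2) y (EuclideanSpace.single 0 1) = 0 :=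
    fun y hy => hcon y hy 0 (by decide)
  have h1 : ∀ y : EuclideanSpace ℝ (Fin 3), y 2 = 0 → fderiv ℝ (fun y : EuclideanSpace ℝ (Fin 3) => v (-1) y 2) y (EuclideanSpace.single 1 1) = 0 :=
    fun y hy => hcon y hy 1 (by decide)
  exact hne (eq_on_plane_of_horizFDeriv_eq_zero hd h0 h1 y' 0 hy' (by simp))

/-- The same with the derivative written through the field: `(D(v(−1))(y₁) e_c)₂ ≠ 0` (the form `hne` of `…TwistingTHSlopeFunction.exists_slopeFunction_near_plane`). -/
theorem exists_fderiv_two_ne_zero_of_properRidge {v : ℝ → EuclideanSpace ℝ (Fin 3) → EuclideanSpace ℝ (Fin 3)}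
    (hd : Differentiable ℝ (v (-1)))
    (hproper : ∃ y' : EuclideanSpace ℝ (Fin 3), y' 2 = 0 ∧ v (-1) y' 2 ≠ v (-1) 0 2) :
    ∃ y₁ : EuclideanSpace ℝ (Fin 3), y₁ 2 = 0 ∧ ∃ c : Fin 3, c ≠ 2 ∧ fderiv ℝ (v (-1)) y₁ (EuclideanSpace.single c 1) 2 ≠ 0 := by
  have hd2 : Differentiable ℝ fun y : EuclideanSpace ℝ (Fin 3) => v (-1) y 2 := fun y =>
    (EuclideanSpace.proj (𝕜 := ℝ) (2 : Fin 3)).differentiableAt.comp y (hd y)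
  obtain ⟨y₁, hy₁, c, hc, hne⟩ := exists_horizFDeriv_ne_zero_of_properRidge hd2 hproper
  refine ⟨y₁, hy₁, c, hc, ?_⟩
  have hcomp : fderiv ℝ (fun y : EuclideanSpace ℝ (Fin 3) => v (-1) y 2) y₁ (EuclideanSpace.single c 1) =
      fderiv ℝ (v (-1)) y₁ (EuclideanSpace.single c 1) 2 := by
    have h := ((EuclideanSpace.proj (𝕜 := ℝ) (2 : Fin 3)).hasFDerivAt.comp y₁ (hd y₁).hasFDerivAt).fderiv
    rw [show (fun y : EuclideanSpace ℝ (Fin 3) => v (-1) y 2) = (EuclideanSpace.proj (𝕜 := ℝ) (2 : Fin 3)) ∘ v (-1) from rfl, h]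
    rfl
  rwa [hcomp] at hne

end Summit.NavierStokesRegularity.NavierStokesRegularity.Theorems.PoloidalWindowDoorLrcModEntireTwistingTHNonflatPlane
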